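import Summits.BirchSwinnertonDyer.BirchSwinnertonDyer.Theorems.PrintCFramBottomClassIndexLawFiveLeSelmerCountClassSide
import HarnessLib

/-!
# Route `PrintCFram`, crux C2 `BottomClassIndexLawFiveLe` (stmt-BirchSwinnertonDyer-20372), line
# `eisenstein-resource-bdp-line` (registry v19, stub B1 `stub_bsdp_of_classFactor`): **EVEN-REGULARITY FROM ONE CLASS GROUP** —
# `#H¹(Γ_ℚ, A; ∅) ≤ #e_{θ̃}(ℤ_p ⊗ Cl_L)` for a character module `A` of ANY parity, Mazur–Wiles-free
# (cell `bsd-print-cfram`, width seat `bsd-line-cfram-p1-w2` g10; helper `--supports` 20372; 0 defs, 0 facts, 0 sorry)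

HONEST FRAMING. Nothing about BSD is proved here and no stub is closed. This is the DICTIONARY for the hypothesis EVEN-REGULAR(`W`,`p`) of
the sibling file `…SelmerCountEvenRegular` (`SelmerCount.natCard_selmerGroup_le_sq_of_evenRegular`: at `v_p(B_{1,ψ⁻¹}) = 1`, EVEN-REGULAR ⟹
`#Sel_p(W/ℚ) ≤ p²` with no case hypothesis): «the constituent of `W[p]` carrying the EVEN character `θ_e = ω ψ⁻¹` has
`#H¹(Γ_ℚ, ·; ∅) ≤ 1`». Seat g9's bridge (`SelmerCount.exists_characters_natCard_h1Unramified_le`) and w7 g3's Hilbert-class-field count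
(`HerbrandOddClassGroup.finite_and_natCard_le_classGroupChiCard_of_unramified_characters`) use NO parity and NO Mazur–Wiles, so they bound
the everywhere-unramified classes of ANY character module by the `θ̃`-part of a `p`-class group; w7 g3 / `…SelmerCountClassSide` recorded only
the ODD composite (with Mazur–Wiles, `= p^{v_p(B_{1,ψ⁻¹})}`). Here:

* **`natCard_h1Unramified_empty_le_classGroupChiCard_of_avatar`** — `A` of order `p` (`p` odd) with character `θ : Γ_ℚ →* 𝔽_pˣ`, `L/ℚ` Galois with
  `p ∤ [L:ℚ]`, `θ(res Γ_L) = 1`, `(ker θ)^k ⊆ res Γ_L` (`p ∤ k`), `θ̃ : Gal(L/ℚ) →* ℤ_pˣ` lifting `θ` ⊢ `#h1Unramified A ∅ ≤ classGroupChiCard ℚ L p θ̃`.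
* **`natCard_h1Unramified_empty_le_one_of_classGroupChiCard_eq_one`** — hence `#e_{θ̃}(ℤ_p ⊗ Cl_L) = 1 ⟹ #H¹(Γ_ℚ, A; ∅) ≤ 1`.
* **`exists_field_natCard_h1Unramified_empty_le_classGroupChiCard`** — the canonical choice `L = ℚ̄^{ker θ}`, `θ̃ = Teich ∘ θ`: EVEN-REGULARITY
  of a class member is decided by the `θ̃_e`-part of the `p`-class group of the (real, abelian) field cut out by `θ_e`. By Leopoldt's reflection
  this part has rank `u(ψ) − 1` or `u(ψ)`; on B1 with `v_p(B_{1,ψ⁻¹}) = 1` both values `0` (even-regular) and `1` occur a priori.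

THEOREMS ONLY; no definition, no named fact, no `sorry`. BSD is not proved by any of this; no summit statement is proved by this seat.
References: [NeukirchANT1999] Ch. VI §7 (7.1) (Hilbert class field); [SerreGaloisCohomology1997] I.§2.6 (b); [Washington1997] §10.2
(Thm. 10.9, reflection); seat notes w2g8 §4, w2g9 §2, w7g3.
-/

set_option autoImplicit false
-- `…BirchSwinnertonDyer.BirchSwinnertonDyer.Theorems…` is the problem's mandated namespace (D-0017).
set_option linter.dupNamespace false

noncomputable section

open scoped Classical Pointwise

namespace Summit.BirchSwinnertonDyer.BirchSwinnertonDyer.Theorems.PrintCFram.SelmerCount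

open NumberField IsDedekindDomain Field
open Literature.NumberTheory.NumberFields Literature.NumberTheory.EllipticCurves Literature.NumberTheory.GaloisRepresentations
  Literature.NumberTheory.EllipticCurves.GreenbergSelmer
open Summit.BirchSwinnertonDyer.BirchSwinnertonDyer.Theorems.PrintCFram.HerbrandSelmerToHom
open Summit.BirchSwinnertonDyer.BirchSwinnertonDyer.Theorems.PrintCFram.LevelDictionaryAlpha

variable {p : ℕ} [hp : Fact p.Prime]

section Dictionary

variable {A : Type} [AddCommGroup A] [DistribMulAction (absoluteGaloisGroup ℚ) A] [TopologicalSpace A] [DiscreteTopology A]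

/-- **`#H¹(Γ_ℚ, A; ∅) ≤ #e_{θ̃}(ℤ_p ⊗ Cl_L)` — ANY parity, no Mazur–Wiles.** `A` a discrete `Γ_ℚ`-module of prime order `p` (`p` odd) with
continuous orbit maps, acted on non-trivially through `θ : Γ_ℚ →* 𝔽_pˣ`; `L/ℚ` finite Galois with `p ∤ [L:ℚ]`, `θ` trivial on `res Γ_L` and
`(ker θ)^k ⊆ res Γ_L` for some `p ∤ k` (e.g. `L = ℚ̄^{ker θ}`, `k = 1`: `LevelDictionaryAlpha.exists_field_of_character`); `θ̃ : Gal(L/ℚ) →* ℤ_pˣ`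
any lift of `θ` (`θ̃(τ̄) ≡ θ(τ) mod p`; e.g. the Teichmüller lift). THEN the everywhere-unramified classes of `H¹(Γ_ℚ, A)` number at most
`classGroupChiCard ℚ L p θ̃ = #e_{θ̃}(ℤ_p ⊗ Cl_L)`. Proof: seat g9's bridge to `θ`-isotypic everywhere-unramified characters of `Γ_L`
(`SelmerCount.exists_characters_natCard_h1Unramified_le`, `S = ∅`) and w7 g3's Hilbert-class-field count
(`HerbrandOddClassGroup.finite_and_natCard_le_classGroupChiCard_of_unramified_characters`), which uses no parity. For an ODD `θ` and
Mazur–Wiles this is `SelmerCountClassSide.natCard_h1Unramified_empty_le_pow_of_odd_avatar`; the point here is the EVEN case.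
[cite: NeukirchANT1999, Ch. VI §7 Thm. (7.1)] [cite: SerreGaloisCohomology1997, I.§2.6 (b)] [cite: Washington1997, §10.2] -/
theorem natCard_h1Unramified_empty_le_classGroupChiCard_of_avatar (hp2 : p ≠ 2) (hcard : Nat.card A = p)
    (hcont : ∀ a : A, Continuous fun g : absoluteGaloisGroup ℚ ↦ g • a)
    (hnt : ∃ (g : absoluteGaloisGroup ℚ) (a : A), g • a ≠ a)
    (θ : absoluteGaloisGroup ℚ →* (ZMod p)ˣ)
    (hθ : ∀ (g : absoluteGaloisGroup ℚ) (a : A), g • a = (((θ g : ZMod p).val : ℕ) : ℤ) • a)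
    (hker : ∀ g : absoluteGaloisGroup ℚ, θ g = 1 ↔ ∀ a : A, g • a = a)
    (L : Type) [Field L] [NumberField L] [IsGalois ℚ L] (hpL : ¬ p ∣ Module.finrank ℚ L)
    (hrL : ∀ σ : absoluteGaloisGroup L, θ (absGaloisRestrict ℚ L σ) = 1)
    (hpow : ∃ k : ℕ, ¬ p ∣ k ∧ ∀ n : absoluteGaloisGroup ℚ, θ n = 1 → n ^ k ∈ (absGaloisRestrict ℚ L).range)
    (θt : (L ≃ₐ[ℚ] L) →* ℤ_[p]ˣ)
    (hθt : ∀ τ : absoluteGaloisGroup ℚ,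
      PadicInt.toZMod ((θt (absGaloisQuot ℚ L τ) : ℤ_[p]ˣ) : ℤ_[p]) = ((θ τ : (ZMod p)ˣ) : ZMod p)) :
    Nat.card ↥(h1Unramified A (∅ : Set (HeightOneSpectrum (𝓞 ℚ)))) ≤ classGroupChiCard ℚ L p (fun g => ((θt g : ℤ_[p]ˣ) : ℤ_[p])) := by
  obtain ⟨V, hVopen, hVunr, hVeq, hVle⟩ :=
    exists_characters_natCard_h1Unramified_le hcard hcont hnt θ hθ hker hrL hpow (∅ : Set (HeightOneSpectrum (𝓞 ℚ)))
  obtain ⟨hfin, hle⟩ := HerbrandOddClassGroup.finite_and_natCard_le_classGroupChiCard_of_unramified_characters hp2 hpL θ θt hθt V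
    hVopen (fun κ hκ w 𝔓 h𝔓 g hg => hVunr κ hκ w (Set.notMem_empty _) 𝔓 h𝔓 g hg) hVeq
  exact (hVle hfin).trans hle

/-- **EVEN-REGULARITY from a trivial `θ̃`-part of the `p`-class group.** With the data of
`natCard_h1Unramified_empty_le_classGroupChiCard_of_avatar`: if `#e_{θ̃}(ℤ_p ⊗ Cl_L) = 1` (`p ∤` the `θ̃`-part of the class number of `L`)
then `#H¹(Γ_ℚ, A; ∅) ≤ 1` — the conjunct of the hypothesis EVEN-REGULAR of `natCard_selmerGroup_le_sq_of_evenRegular` for the constituent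
`A ∈ {Φ, W[p]/Φ}` carrying the even character `θ = θ_e`. (For the ODD constituent the same hypothesis never holds on B1: there
`#e_{ψ̃}(ℤ_p ⊗ Cl) = p^{v_p(B_{1,ψ⁻¹})} ≥ p` by Mazur–Wiles.) [cite: NeukirchANT1999, Ch. VI §7 Thm. (7.1)] [cite: Washington1997, §10.2] -/
theorem natCard_h1Unramified_empty_le_one_of_classGroupChiCard_eq_one (hp2 : p ≠ 2) (hcard : Nat.card A = p)
    (hcont : ∀ a : A, Continuous fun g : absoluteGaloisGroup ℚ ↦ g • a)
    (hnt : ∃ (g : absoluteGaloisGroup ℚ) (a : A), g • a ≠ a)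
    (θ : absoluteGaloisGroup ℚ →* (ZMod p)ˣ)
    (hθ : ∀ (g : absoluteGaloisGroup ℚ) (a : A), g • a = (((θ g : ZMod p).val : ℕ) : ℤ) • a)
    (hker : ∀ g : absoluteGaloisGroup ℚ, θ g = 1 ↔ ∀ a : A, g • a = a)
    (L : Type) [Field L] [NumberField L] [IsGalois ℚ L] (hpL : ¬ p ∣ Module.finrank ℚ L)
    (hrL : ∀ σ : absoluteGaloisGroup L, θ (absGaloisRestrict ℚ L σ) = 1)
    (hpow : ∃ k : ℕ, ¬ p ∣ k ∧ ∀ n : absoluteGaloisGroup ℚ, θ n = 1 → n ^ k ∈ (absGaloisRestrict ℚ L).range)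
    (θt : (L ≃ₐ[ℚ] L) →* ℤ_[p]ˣ)
    (hθt : ∀ τ : absoluteGaloisGroup ℚ,
      PadicInt.toZMod ((θt (absGaloisQuot ℚ L τ) : ℤ_[p]ˣ) : ℤ_[p]) = ((θ τ : (ZMod p)ˣ) : ZMod p))
    (h1 : classGroupChiCard ℚ L p (fun g => ((θt g : ℤ_[p]ˣ) : ℤ_[p])) = 1) :
    Nat.card ↥(h1Unramified A (∅ : Set (HeightOneSpectrum (𝓞 ℚ)))) ≤ 1 :=
  (natCard_h1Unramified_empty_le_classGroupChiCard_of_avatar hp2 hcard hcont hnt θ hθ hker L hpL hrL hpow θt hθt).trans h1.le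

/-- **The canonical choice `L = ℚ̄^{ker θ}`, `θ̃ = Teich ∘ θ`.** For `A`, `θ` as above there IS a finite abelian `L/ℚ` with `p ∤ [L:ℚ]`, `θ`
trivial exactly on `res Γ_L`, and a lift `θ̃` of `θ` to `Gal(L/ℚ)` with `#H¹(Γ_ℚ, A; ∅) ≤ #e_{θ̃}(ℤ_p ⊗ Cl_L)` — so EVEN-REGULARITY of a class
member is decided by ONE class group: that of the field cut out by the even character `θ_e = ω ψ⁻¹` of its rational line.
[cite: NeukirchANT1999, Ch. VI §7 Thm. (7.1)] [cite: Washington1997, §10.2] -/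
theorem exists_field_natCard_h1Unramified_empty_le_classGroupChiCard (hp2 : p ≠ 2) (hcard : Nat.card A = p)
    (hcont : ∀ a : A, Continuous fun g : absoluteGaloisGroup ℚ ↦ g • a)
    (hnt : ∃ (g : absoluteGaloisGroup ℚ) (a : A), g • a ≠ a)
    (θ : absoluteGaloisGroup ℚ →* (ZMod p)ˣ)
    (hθ : ∀ (g : absoluteGaloisGroup ℚ) (a : A), g • a = (((θ g : ZMod p).val : ℕ) : ℤ) • a)
    (hker : ∀ g : absoluteGaloisGroup ℚ, θ g = 1 ↔ ∀ a : A, g • a = a) :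
    ∃ (L : Type) (_ : Field L) (_ : NumberField L) (_ : IsGalois ℚ L) (θt : (L ≃ₐ[ℚ] L) →* ℤ_[p]ˣ),
      ¬ p ∣ Module.finrank ℚ L ∧ (∀ g : absoluteGaloisGroup ℚ, g ∈ (absGaloisRestrict ℚ L).range ↔ θ g = 1) ∧
      (∀ τ : absoluteGaloisGroup ℚ, PadicInt.toZMod ((θt (absGaloisQuot ℚ L τ) : ℤ_[p]ˣ) : ℤ_[p]) = ((θ τ : (ZMod p)ˣ) : ZMod p)) ∧
      Nat.card ↥(h1Unramified A (∅ : Set (HeightOneSpectrum (𝓞 ℚ)))) ≤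
        classGroupChiCard ℚ L p (fun g => ((θt g : ℤ_[p]ˣ) : ℤ_[p])) := by
  obtain ⟨L, _, _, _, hrange, hpL, hrL⟩ := exists_field_of_character θ (isOpen_ker_character hcard hcont θ hker)
  haveI : IsGalois ℚ L := IsAbelianGalois.toIsGalois
  -- the Teichmüller lift of `θ`, descended to `Gal(L/ℚ)`
  set φ : absoluteGaloisGroup ℚ →* ℤ_[p]ˣ := (Kato2004.teichmullerChar p).comp θ with hφdef
  have hφL : ∀ σ : absoluteGaloisGroup L, φ (absGaloisRestrict ℚ L σ) = 1 := fun σ => by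
    rw [hφdef, MonoidHom.comp_apply, hrL, map_one]
  obtain ⟨θt, hθt⟩ := HerbrandOddClassGroup.exists_factor_absGaloisQuot ℚ L φ hφL
  have hθt' : ∀ τ : absoluteGaloisGroup ℚ,
      PadicInt.toZMod ((θt (absGaloisQuot ℚ L τ) : ℤ_[p]ˣ) : ℤ_[p]) = ((θ τ : (ZMod p)ˣ) : ZMod p) := fun τ => by
    rw [hθt, hφdef, MonoidHom.comp_apply, Kato2004.toZMod_teichmullerChar]
  exact ⟨L, inferInstance, inferInstance, inferInstance, θt, hpL, hrange, hθt',
    natCard_h1Unramified_empty_le_classGroupChiCard_of_avatar hp2 hcard hcont hnt θ hθ hker L hpL hrL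
      ⟨1, hp.out.not_dvd_one, fun g hg => by rw [pow_one]; exact (hrange g).2 hg⟩ θt hθt'⟩

end Dictionary

end Summit.BirchSwinnertonDyer.BirchSwinnertonDyer.Theorems.PrintCFram.SelmerCount

end
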